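import Literature.Topology.FourManifolds.CollarCriterion
import Summits.SmoothPoincare4.SmoothPoincare4.Theorems.CongruenceShadowsAgkCor6SufficiencyStubSeamDiffeosTools

/-!
# The `Ξ`-collars of the seams, for stub `stub_seamDiffeos` of line `lp-by-sphere-system-surgery`
(crux `AgkCor6Sufficiency`, item stmt-SmoothPoincare4-10894, routes CongruenceShadows /
GroupTrisection; lead reshape r5, B2)

For a seam `H_m = S (m+1) ∩ S (m+2) = hd(H)` of a trisection in tri-normal form with a tube
structure `(Ot, rt, tp)` (`Ξ = (ρ, u, v) : Ot ≅ F × D_rt`), the handlebody `H` carries OPEN COLLAR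
DATA (`BoundaryData.OpenCollarData`, `CollarCriterion.lean`) read off `Ξ`: the collar line through
the boundary point `x` is the ray of the seam over `hd x`,
`t ↦ hd⁻¹ (tp (hd x) (u, v)(p = sc·t, q = 0))`, the projection is `z ↦ (hd|∂H)⁻¹ (ρ (hd z))` and the
height is `p_m (hd z) / sc` (`exists_xiCollar`).  With these collars on both sides, a map
`Θ : H → H'` which is PRODUCT-LIKE (`Θ (D x t) = D' (θ x) t`, `t ≤ ε`) over a boundary map `θ`
covering `Ψa` reads, inside the tube `T(rP)`, `rP ≤ sc · min ε 1`, as the product map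
`hd' ∘ Θ = tp' (Ψa ∘ ρ, u, v) ∘ hd` (`product_formula`).  Registered helper stub
`stub_seamDiffeosCollarToolkit : SeamDiffeosCollarToolkit`.

References: Abrams–Gay–Kirby, Geom. Topol. 22 (2018), proof of Thm. 5; Hirsch, *Differential
Topology* (1976), Ch. 8 §1 (uniqueness of collars); Milnor, *Lectures on the h-cobordism theorem*
(1965), proof of Thm. 3.4 (collars from transverse flows).
-/

noncomputable section

-- the prescribed namespace `Summit.<P>.<Sub>.…` duplicates `SmoothPoincare4` (P = Sub)
set_option linter.dupNamespace false

namespace Summit.SmoothPoincare4.SmoothPoincare4.Cruxes.AgkCor6Sufficiency.LpBySphereSystemSurgery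

open Set Function Filter
open scoped _root_.Manifold _root_.ContDiff _root_.Topology
open Literature.Topology.FourManifolds

namespace B2

/-- The ray of seam `m` starts at the origin of the normal plane. -/
theorem uOfPQ_zero (m : Fin 3) : uOfPQ m 0 0 = 0 ∧ vOfPQ m 0 0 = 0 := by
  obtain ⟨α, β, h, -, -⟩ := ray_linear m
  rw [(h 0).1, (h 0).2, mul_zero, mul_zero]
  exact ⟨rfl, rfl⟩

/-- The ray point with parameter `sc · t`, `|t| < 2`, `3 sc ≤ rt`, lies in the disc of radius `rt`. -/
theorem sq_ray_lt (m : Fin 3) {sc rt t : ℝ} (hsc : 0 < sc) (hsc' : 3 * sc ≤ rt) (ht : |t| < 2) :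
    uOfPQ m (sc * t) 0 ^ 2 + vOfPQ m (sc * t) 0 ^ 2 < rt ^ 2 := by
  refine lt_of_le_of_lt (sq_ray m (sc * t)).2 ?_
  have ht2 : t ^ 2 < 4 := by
    have h := abs_lt.1 ht
    nlinarith [h.1, h.2]
  nlinarith [mul_pos hsc hsc, ht2, hsc']

section Collar

variable {X : Type} [TopologicalSpace X] [ChartedSpace (EuclideanSpace ℝ (Fin 4)) X]
  {S : Fin 3 → Set X} {u v : X → ℝ} {ρ : X → X} {U O Ot : Set X} {rt : ℝ} {tp : X → ℝ → ℝ → X}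
  {c : Fin 3 → ℕ → ℕ} {m : Fin 3}
  {H : Type} [TopologicalSpace H] [ChartedSpace (EuclideanHalfSpace 3) H]
  {hd : H → X}

/-- A ray point `tp p (ray (sc t))`, `p ∈ F`, `0 ≤ t < 2`, lies on the seam `H_m` inside `Ot`,
with `Ξ`-coordinates `(p, ray (sc t))` and seam coordinates `(p_m, q_m) = (sc t, 0)`. -/
theorem ray_point (hT : TriNormalForm S 0 1 2 u v ρ U O c)
    (hTS : TubeStructure (S 0) (⋂ l, S l) u v ρ O Ot rt tp) {sc : ℝ} (hsc : 0 < sc)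
    (hsc' : 3 * sc ≤ rt) {p : X} (hp : p ∈ ⋂ l, S l) {t : ℝ} (ht : t ∈ Ico (0 : ℝ) 2) :
    tp p (uOfPQ m (sc * t) 0) (vOfPQ m (sc * t) 0) ∈ Ot ∧
    tp p (uOfPQ m (sc * t) 0) (vOfPQ m (sc * t) 0) ∈ S (m + 1) ∩ S (m + 2) ∧
    ρ (tp p (uOfPQ m (sc * t) 0) (vOfPQ m (sc * t) 0)) = p ∧
    u (tp p (uOfPQ m (sc * t) 0) (vOfPQ m (sc * t) 0)) = uOfPQ m (sc * t) 0 ∧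
    v (tp p (uOfPQ m (sc * t) 0) (vOfPQ m (sc * t) 0)) = vOfPQ m (sc * t) 0 ∧
    pCo m (u (tp p (uOfPQ m (sc * t) 0) (vOfPQ m (sc * t) 0)))
      (v (tp p (uOfPQ m (sc * t) 0) (vOfPQ m (sc * t) 0))) = sc * t := by
  have hab : uOfPQ m (sc * t) 0 ^ 2 + vOfPQ m (sc * t) 0 ^ 2 < rt ^ 2 :=
    sq_ray_lt m hsc hsc' (abs_lt.2 ⟨by linarith [ht.1], ht.2⟩)
  have hOt := hTS.tp_mem p hp _ _ hab
  have hρ := hTS.ρ_tp p hp _ _ hab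
  have hu := hTS.u_tp p hp _ _ hab
  have hv := hTS.v_tp p hp _ _ hab
  have hU : tp p (uOfPQ m (sc * t) 0) (vOfPQ m (sc * t) 0) ∈ U :=
    hT.frame.O_subset_U (hTS.subset_O hOt)
  have hpq : pCo m (u (tp p (uOfPQ m (sc * t) 0) (vOfPQ m (sc * t) 0)))
      (v (tp p (uOfPQ m (sc * t) 0) (vOfPQ m (sc * t) 0))) = sc * t := by
    rw [hu, hv, pCo_uOfPQ_vOfPQ]
  refine ⟨hOt, ?_, hρ, hu, hv, hpq⟩
  rw [seam_iff hT m hU, hpq, hu, hv, qCo_uOfPQ_vOfPQ]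
  exact ⟨rfl, mul_nonneg hsc.le ht.1⟩

variable [IsManifold (𝓡∂ 3) ∞ H] [IsManifold (𝓡 4) ∞ X]

/-- **The `Ξ`-collar of a seam.**  For the clause-(iii) embedding `hd : H → X` of the seam
`H_m = S (m+1) ∩ S (m+2)` (`hd(∂H) = F`), a boundary datum `b` of `H`, a default point `w₀`
and a scale `0 < sc`, `3 sc ≤ rt`, open collar data `D` for `b` with: `top = 2`,
`region = {z | hd z ∈ Ot, p_m (hd z) < 2 sc}`, `height z = p_m (hd z) / sc`,
`hd (incl (proj z)) = ρ (hd z)` on the region, and collar lines the rays of the seam: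
`hd (D x t) = tp (hd (incl x)) (ray (sc t))` for `0 ≤ t < 2`.  (The inverse of `Ξ` along the
seam, lifted through the smooth embedding `hd`; smoothness by `TubeStructure.contMDiffOn_tp` and
`contMDiffOn_of_embedding_comp`.) -/
theorem exists_xiCollar (hT : TriNormalForm S 0 1 2 u v ρ U O c)
    (hTS : TubeStructure (S 0) (⋂ l, S l) u v ρ O Ot rt tp)
    (hhd : Manifold.IsSmoothEmbedding (𝓡∂ 3) (𝓡 4) ∞ hd) (hrange : range hd = S (m + 1) ∩ S (m + 2))
    (hbd : hd '' (𝓡∂ 3).boundary H = ⋂ l, S l)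
    (b : BoundaryData (𝓡∂ 3) H (𝓡 2)) (w₀ : b.carrier) {sc : ℝ} (hsc : 0 < sc) (hsc' : 3 * sc ≤ rt) :
    ∃ D : b.OpenCollarData, D.top = 2 ∧
      D.region = {z | hd z ∈ Ot ∧ pCo m (u (hd z)) (v (hd z)) < 2 * sc} ∧
      (∀ z, D.height z = pCo m (u (hd z)) (v (hd z)) / sc) ∧
      (∀ z ∈ D.region, hd (b.incl (D.proj z)) = ρ (hd z)) ∧
      (∀ x, ∀ t ∈ Ico (0 : ℝ) 2,
        hd (D.toFun x t) = tp (hd (b.incl x)) (uOfPQ m (sc * t) 0) (vOfPQ m (sc * t) 0)) := by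
  have hfr := hT.frame
  have hinj : Injective hd := hhd.isEmbedding.injective
  have hcont : Continuous hd := hhd.isEmbedding.continuous
  have hinjb : Injective (fun x : b.carrier => hd (b.incl x)) := hinj.comp b.injective_incl
  -- `hd ∘ incl` maps onto `F`
  have hFb : ∀ x : b.carrier, hd (b.incl x) ∈ ⋂ l, S l := fun x => by
    rw [← hbd]
    exact mem_image_of_mem hd (b.incl_mem_boundary x)
  have hFr : ∀ p ∈ ⋂ l, S l, ∃ x : b.carrier, hd (b.incl x) = p := by
    intro p hp
    rw [← hbd] at hp
    obtain ⟨z, hz, rfl⟩ := hp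
    rw [← b.range_incl] at hz
    obtain ⟨x, rfl⟩ := hz
    exact ⟨x, rfl⟩
  have hFH : (⋂ l, S l) ⊆ range hd := by
    rw [hrange]
    exact fun x hx => ⟨mem_iInter.1 hx _, mem_iInter.1 hx _⟩
  -- the data
  set toF : b.carrier → ℝ → H := fun x t =>
    liftVia hd (b.incl x) (tp (hd (b.incl x)) (uOfPQ m (sc * t) 0) (vOfPQ m (sc * t) 0)) with htoF
  set prj : H → b.carrier := fun z =>
    liftVia (fun x : b.carrier => hd (b.incl x)) w₀ (ρ (hd z)) with hprj
  set reg : Set H := {z | hd z ∈ Ot ∧ pCo m (u (hd z)) (v (hd z)) < 2 * sc} with hreg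
  -- (K1) the collar lines are the rays
  have K1 : ∀ x, ∀ t ∈ Ico (0 : ℝ) 2,
      hd (toF x t) = tp (hd (b.incl x)) (uOfPQ m (sc * t) 0) (vOfPQ m (sc * t) 0) := by
    intro x t ht
    apply apply_liftVia
    have h := (ray_point (m := m) hT hTS hsc hsc' (hFb x) ht).2.1
    rw [← hrange] at h
    exact h
  -- (K2) points of the region are seam points of the tube
  have K2 : ∀ z ∈ reg, hd z ∈ U ∧ qCo m (u (hd z)) (v (hd z)) = 0 ∧ 0 ≤ pCo m (u (hd z)) (v (hd z)) := by
    intro z hz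
    have hU : hd z ∈ U := hfr.O_subset_U (hTS.subset_O hz.1)
    have hH : hd z ∈ S (m + 1) ∩ S (m + 2) := hrange ▸ mem_range_self z
    exact ⟨hU, (seam_iff hT m hU).1 hH⟩
  -- (K3) the projection covers `ρ`
  have K3 : ∀ z, hd z ∈ Ot → hd (b.incl (prj z)) = ρ (hd z) := fun z hz =>
    apply_liftVia (fun x : b.carrier => hd (b.incl x)) w₀ (hFr _ (hfr.ρ_mem _ (hTS.subset_O hz)))
  -- smoothness of `p_m ∘ hd`
  obtain ⟨α, β, hαβ⟩ := pCo_linear m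
  have hpC : ContMDiff (𝓡∂ 3) 𝓘(ℝ, ℝ) ∞ (fun z => pCo m (u (hd z)) (v (hd z))) := by
    have h1 : ContMDiff 𝓘(ℝ, ℝ × ℝ) 𝓘(ℝ, ℝ) ∞ (fun p : ℝ × ℝ => α * p.1 + β * p.2) :=
      contMDiff_iff_contDiff.2 (by fun_prop)
    have he : (fun z => pCo m (u (hd z)) (v (hd z))) =
        (fun p : ℝ × ℝ => α * p.1 + β * p.2) ∘ fun z => (u (hd z), v (hd z)) :=
      funext fun z => hαβ _ _
    rw [he]
    exact h1.comp ((hfr.contMDiff_u.comp hhd.contMDiff).prodMk_space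
      (hfr.contMDiff_v.comp hhd.contMDiff))
  have hrego : IsOpen reg :=
    (hTS.isOpen.preimage hcont).inter (isOpen_lt hpC.continuous continuous_const)
  refine ⟨{ toFun := toF
            proj := prj
            height := fun z => pCo m (u (hd z)) (v (hd z)) / sc
            top := 2
            region := reg
            one_lt_top := by norm_num
            isOpen_region := hrego
            apply_zero := ?_
            mem_region := ?_
            proj_apply := ?_
            height_apply := ?_
            height_mem := ?_
            apply_proj_height := ?_
            contMDiffOn_toFun := ?_
            contMDiffOn_proj := ?_
            contMDiffOn_height := ?_ }, rfl, rfl, fun z => rfl, fun z hz => K3 z hz.1, K1⟩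
  · -- apply_zero
    intro x
    show liftVia hd (b.incl x) (tp (hd (b.incl x)) (uOfPQ m (sc * 0) 0) (vOfPQ m (sc * 0) 0)) = b.incl x
    rw [mul_zero, (uOfPQ_zero m).1, (uOfPQ_zero m).2, hTS.tp_zero hfr (hFb x)]
    exact liftVia_apply hinj _ _
  · -- mem_region
    intro x t ht
    obtain ⟨hOt, -, -, -, -, hpq⟩ := ray_point (m := m) hT hTS hsc hsc' (hFb x) ht
    refine ⟨?_, ?_⟩
    · show hd (toF x t) ∈ Ot
      rw [K1 x t ht]
      exact hOt
    · show pCo m (u (hd (toF x t))) (v (hd (toF x t))) < 2 * sc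
      rw [K1 x t ht, hpq]
      nlinarith [ht.2]
  · -- proj_apply
    intro x t ht
    obtain ⟨-, -, hρ, -⟩ := ray_point (m := m) hT hTS hsc hsc' (hFb x) ht
    show liftVia (fun x : b.carrier => hd (b.incl x)) w₀ (ρ (hd (toF x t))) = x
    apply liftVia_eq hinjb
    show hd (b.incl x) = ρ (hd (toF x t))
    rw [K1 x t ht, hρ]
  · -- height_apply
    intro x t ht
    obtain ⟨-, -, -, -, -, hpq⟩ := ray_point (m := m) hT hTS hsc hsc' (hFb x) ht
    show pCo m (u (hd (toF x t))) (v (hd (toF x t))) / sc = t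
    rw [K1 x t ht, hpq, mul_div_cancel_left₀ _ hsc.ne']
  · -- height_mem
    intro z hz
    obtain ⟨-, -, hp⟩ := K2 z hz
    refine ⟨div_nonneg hp hsc.le, ?_⟩
    show pCo m (u (hd z)) (v (hd z)) / sc < 2
    rw [div_lt_iff₀ hsc]
    linarith [hz.2]
  · -- apply_proj_height
    intro z hz
    obtain ⟨-, hq, -⟩ := K2 z hz
    obtain ⟨hu, hv⟩ := uv_of_qCo_eq_zero m hq
    show liftVia hd (b.incl (prj z)) (tp (hd (b.incl (prj z)))
      (uOfPQ m (sc * (pCo m (u (hd z)) (v (hd z)) / sc)) 0)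
      (vOfPQ m (sc * (pCo m (u (hd z)) (v (hd z)) / sc)) 0)) = z
    apply liftVia_eq hinj
    rw [K3 z hz.1, mul_div_cancel₀ _ hsc.ne', hu, hv, hTS.tp_self _ hz.1]
  · -- smoothness of the collar map: through `hd` it is `tp` along smooth data
    obtain ⟨α', β', hray, -, -⟩ := ray_linear m
    have hg : ContMDiffOn ((𝓡 2).prod 𝓘(ℝ, ℝ)) (𝓡 4) ∞
        (fun q : b.carrier × ℝ => tp (hd (b.incl q.1)) (uOfPQ m (sc * q.2) 0) (vOfPQ m (sc * q.2) 0))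
        (univ ×ˢ Ico (0 : ℝ) 2) := by
      refine hTS.contMDiffOn_tp ?_ ?_ ?_ (fun q _ => hFb q.1) (fun q hq => ?_)
      · exact (hhd.contMDiff.comp (b.isSmoothEmbedding.contMDiff.comp contMDiff_fst)).contMDiffOn
      · have h1 : ContMDiff 𝓘(ℝ, ℝ) 𝓘(ℝ, ℝ) ∞ (fun t : ℝ => α' * (sc * t)) :=
          contMDiff_iff_contDiff.2 (by fun_prop)
        have he : (fun q : b.carrier × ℝ => uOfPQ m (sc * q.2) 0) = (fun t : ℝ => α' * (sc * t)) ∘ Prod.snd :=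
          funext fun q => (hray _).1
        rw [he]
        exact (h1.comp contMDiff_snd).contMDiffOn
      · have h1 : ContMDiff 𝓘(ℝ, ℝ) 𝓘(ℝ, ℝ) ∞ (fun t : ℝ => β' * (sc * t)) :=
          contMDiff_iff_contDiff.2 (by fun_prop)
        have he : (fun q : b.carrier × ℝ => vOfPQ m (sc * q.2) 0) = (fun t : ℝ => β' * (sc * t)) ∘ Prod.snd :=
          funext fun q => (hray _).2
        rw [he]
        exact (h1.comp contMDiff_snd).contMDiffOn
      · exact sq_ray_lt m hsc hsc' (abs_lt.2 ⟨by linarith [hq.2.1], hq.2.2⟩)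
    exact contMDiffOn_of_embedding_comp hhd hg fun q hq => K1 q.1 q.2 hq.2
  · -- smoothness of the projection: two lifts
    have h1 : ContMDiffOn (𝓡∂ 3) (𝓡∂ 3) ∞ (fun z => liftVia hd z (ρ (hd z))) reg :=
      contMDiffOn_of_embedding_comp hhd ((hfr.contMDiff_ρ.comp hhd.contMDiff).contMDiffOn)
        fun z hz => apply_liftVia hd z (hFH (hfr.ρ_mem _ (hTS.subset_O hz.1)))
    refine contMDiffOn_of_embedding_comp b.isSmoothEmbedding h1 fun z hz => hinj ?_
    show hd (b.incl (prj z)) = hd (liftVia hd z (ρ (hd z)))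
    rw [K3 z hz.1, apply_liftVia hd z (hFH (hfr.ρ_mem _ (hTS.subset_O hz.1)))]
  · -- smoothness of the height
    have h1 : ContMDiff 𝓘(ℝ, ℝ) 𝓘(ℝ, ℝ) ∞ (fun s : ℝ => s / sc) :=
      contMDiff_iff_contDiff.2 (contDiff_id.div_const sc)
    exact (h1.comp hpC).contMDiffOn

end Collar

/-! ## The product formula -/

section Product

variable {X : Type} [TopologicalSpace X] [ChartedSpace (EuclideanSpace ℝ (Fin 4)) X]
  {S : Fin 3 → Set X} {u v : X → ℝ} {ρ : X → X} {U O Ot : Set X} {rt : ℝ} {tp : X → ℝ → ℝ → X}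
  {c : Fin 3 → ℕ → ℕ} {m : Fin 3}
  {H : Type} [TopologicalSpace H] [ChartedSpace (EuclideanHalfSpace 3) H]
  {hd : H → X} {b : BoundaryData (𝓡∂ 3) H (𝓡 2)}
  {X' : Type} {H' : Type} [TopologicalSpace H'] [ChartedSpace (EuclideanHalfSpace 3) H']
  {hd' : H' → X'} {tp' : X' → ℝ → ℝ → X'} {b' : BoundaryData (𝓡∂ 3) H' (𝓡 2)}

/-- **The product formula.**  Let `D`, `D'` be the `Ξ`-collars of the seams `H_m`, `H'_m`
(`exists_xiCollar`, same scale `sc`), `Θ : H → H'` product-like up to height `ε` over a map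
`θ` of the boundaries which covers `Ψa` (`hd' (incl' (θ x)) = Ψa (hd (incl x))`).  Then for
`hd z` in the tube `T(rP)`, `rP ≤ sc ε`, `rP ≤ sc`:
`hd' (Θ z) = tp' (Ψa (ρ (hd z))) (u (hd z)) (v (hd z))` — the seam point `hd z` has collar
coordinates `(proj z, p_m / sc)` with `p_m ≤ √(u² + v²) < rP`. -/
theorem product_formula (hT : TriNormalForm S 0 1 2 u v ρ U O c)
    (hTS : TubeStructure (S 0) (⋂ l, S l) u v ρ O Ot rt tp)
    (hrange : range hd = S (m + 1) ∩ S (m + 2)) (D : b.OpenCollarData) {sc : ℝ} (hsc : 0 < sc)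
    (hreg : D.region = {z | hd z ∈ Ot ∧ pCo m (u (hd z)) (v (hd z)) < 2 * sc})
    (hhgt : ∀ z, D.height z = pCo m (u (hd z)) (v (hd z)) / sc)
    (hprj : ∀ z ∈ D.region, hd (b.incl (D.proj z)) = ρ (hd z))
    (D' : b'.OpenCollarData)
    (htoF' : ∀ x', ∀ t ∈ Ico (0 : ℝ) 2,
      hd' (D'.toFun x' t) = tp' (hd' (b'.incl x')) (uOfPQ m (sc * t) 0) (vOfPQ m (sc * t) 0))
    {Θ : H → H'} {θ : b.carrier → b'.carrier} {Ψa : X → X'} {ε : ℝ}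
    (hΘ : ∀ x t, 0 ≤ t → t ≤ ε → Θ (D.toFun x t) = D'.toFun (θ x) t)
    (hθ : ∀ x, hd' (b'.incl (θ x)) = Ψa (hd (b.incl x)))
    {rP : ℝ} (hrP : 0 < rP) (hrPε : rP ≤ sc * ε) (hrP1 : rP ≤ sc) :
    ∀ z, hd z ∈ tubeSet Ot u v rP → hd' (Θ z) = tp' (Ψa (ρ (hd z))) (u (hd z)) (v (hd z)) := by
  intro z hz
  have hU : hd z ∈ U := hT.frame.O_subset_U (hTS.subset_O hz.1)
  have hH : hd z ∈ S (m + 1) ∩ S (m + 2) := hrange ▸ mem_range_self z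
  obtain ⟨hq, hp⟩ := (seam_iff hT m hU).1 hH
  obtain ⟨hu, hv⟩ := uv_of_qCo_eq_zero m hq
  set p := pCo m (u (hd z)) (v (hd z)) with hpdef
  have hp2 : p ^ 2 < rP ^ 2 := by
    have h := (sq_ray m p).1
    rw [hu, hv] at h
    exact lt_of_le_of_lt h hz.2
  have hprP : p < rP := lt_of_pow_lt_pow_left₀ 2 hrP.le hp2
  have hzreg : z ∈ D.region := by
    rw [hreg]
    exact ⟨hz.1, by linarith⟩
  have ht0 : 0 ≤ D.height z := by rw [hhgt]; exact div_nonneg hp hsc.le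
  have htε : D.height z ≤ ε := by
    rw [hhgt, div_le_iff₀ hsc]
    linarith
  have ht2 : D.height z < 2 := by
    rw [hhgt, div_lt_iff₀ hsc]
    linarith
  calc hd' (Θ z) = hd' (Θ (D.toFun (D.proj z) (D.height z))) := by rw [D.apply_proj_height z hzreg]
    _ = hd' (D'.toFun (θ (D.proj z)) (D.height z)) := by rw [hΘ _ _ ht0 htε]
    _ = tp' (hd' (b'.incl (θ (D.proj z)))) (uOfPQ m (sc * D.height z) 0)
          (vOfPQ m (sc * D.height z) 0) := htoF' _ _ ⟨ht0, ht2⟩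
    _ = tp' (Ψa (ρ (hd z))) (u (hd z)) (v (hd z)) := by
          rw [hθ, hprj z hzreg, hhgt z, mul_div_cancel₀ _ hsc.ne', hu, hv]

end Product

end B2

/-! ## The registered helper stub -/

/-- **Toolkit of the seam diffeomorphisms, collars** (registered helper stub of
`stub_seamDiffeos`): (1) the `Ξ`-collar of a seam (`B2.exists_xiCollar`); (2) the product formula
for a product-like map between two seams (`B2.product_formula`).  (A conjunction of statements
PROVED in this file, not a named fact.) -/
def SeamDiffeosCollarToolkit : Prop :=
  (∀ (X : Type) [TopologicalSpace X] [ChartedSpace (EuclideanSpace ℝ (Fin 4)) X] [IsManifold (𝓡 4) ∞ X]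
    (S : Fin 3 → Set X) (u v : X → ℝ) (ρ : X → X) (U O Ot : Set X) (rt : ℝ) (tp : X → ℝ → ℝ → X)
    (c : Fin 3 → ℕ → ℕ) (m : Fin 3)
    (H : Type) [TopologicalSpace H] [ChartedSpace (EuclideanHalfSpace 3) H] [IsManifold (𝓡∂ 3) ∞ H]
    (hd : H → X), TriNormalForm S 0 1 2 u v ρ U O c → TubeStructure (S 0) (⋂ l, S l) u v ρ O Ot rt tp →
    Manifold.IsSmoothEmbedding (𝓡∂ 3) (𝓡 4) ∞ hd → range hd = S (m + 1) ∩ S (m + 2) →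
    hd '' (𝓡∂ 3).boundary H = ⋂ l, S l →
    ∀ (b : BoundaryData (𝓡∂ 3) H (𝓡 2)) (_ : b.carrier) (sc : ℝ), 0 < sc → 3 * sc ≤ rt →
    ∃ D : b.OpenCollarData, D.top = 2 ∧
      D.region = {z | hd z ∈ Ot ∧ pCo m (u (hd z)) (v (hd z)) < 2 * sc} ∧
      (∀ z, D.height z = pCo m (u (hd z)) (v (hd z)) / sc) ∧
      (∀ z ∈ D.region, hd (b.incl (D.proj z)) = ρ (hd z)) ∧
      (∀ x, ∀ t ∈ Ico (0 : ℝ) 2,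
        hd (D.toFun x t) = tp (hd (b.incl x)) (uOfPQ m (sc * t) 0) (vOfPQ m (sc * t) 0))) ∧
  (∀ (X : Type) [TopologicalSpace X] [ChartedSpace (EuclideanSpace ℝ (Fin 4)) X]
    (S : Fin 3 → Set X) (u v : X → ℝ) (ρ : X → X) (U O Ot : Set X) (rt : ℝ) (tp : X → ℝ → ℝ → X)
    (c : Fin 3 → ℕ → ℕ) (m : Fin 3)
    (H : Type) [TopologicalSpace H] [ChartedSpace (EuclideanHalfSpace 3) H]
    (hd : H → X) (b : BoundaryData (𝓡∂ 3) H (𝓡 2))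
    (X' H' : Type) [TopologicalSpace H'] [ChartedSpace (EuclideanHalfSpace 3) H']
    (hd' : H' → X') (tp' : X' → ℝ → ℝ → X') (b' : BoundaryData (𝓡∂ 3) H' (𝓡 2)),
    TriNormalForm S 0 1 2 u v ρ U O c → TubeStructure (S 0) (⋂ l, S l) u v ρ O Ot rt tp →
    range hd = S (m + 1) ∩ S (m + 2) → ∀ (D : b.OpenCollarData) (sc : ℝ), 0 < sc →
    D.region = {z | hd z ∈ Ot ∧ pCo m (u (hd z)) (v (hd z)) < 2 * sc} →
    (∀ z, D.height z = pCo m (u (hd z)) (v (hd z)) / sc) →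
    (∀ z ∈ D.region, hd (b.incl (D.proj z)) = ρ (hd z)) →
    ∀ (D' : b'.OpenCollarData),
    (∀ x', ∀ t ∈ Ico (0 : ℝ) 2,
      hd' (D'.toFun x' t) = tp' (hd' (b'.incl x')) (uOfPQ m (sc * t) 0) (vOfPQ m (sc * t) 0)) →
    ∀ (Θ : H → H') (θ : b.carrier → b'.carrier) (Ψa : X → X') (ε : ℝ),
    (∀ x t, 0 ≤ t → t ≤ ε → Θ (D.toFun x t) = D'.toFun (θ x) t) →
    (∀ x, hd' (b'.incl (θ x)) = Ψa (hd (b.incl x))) →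
    ∀ rP : ℝ, 0 < rP → rP ≤ sc * ε → rP ≤ sc →
    ∀ z, hd z ∈ tubeSet Ot u v rP → hd' (Θ z) = tp' (Ψa (ρ (hd z))) (u (hd z)) (v (hd z)))

/-- **Registered helper stub `stub_seamDiffeosCollarToolkit`** of line `lp-by-sphere-system-surgery`
(collar toolkit of the seam diffeomorphisms `stub_seamDiffeos`). -/
theorem stub_seamDiffeosCollarToolkit : SeamDiffeosCollarToolkit :=
  ⟨fun _ _ _ _ _ _ _ _ _ _ _ _ _ _ _ _ _ _ _ _ hT hTS hhd hrange hbd b w₀ _ hsc hsc' =>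
      B2.exists_xiCollar hT hTS hhd hrange hbd b w₀ hsc hsc',
    fun _ _ _ _ _ _ _ _ _ _ _ _ _ _ _ _ _ _ _ _ _ _ _ _ _ _ hT hTS hrange D _ hsc hreg hhgt hprj D'
        htoF' _ _ _ _ hΘ hθ _ hrP hrPε hrP1 =>
      B2.product_formula hT hTS hrange D hsc hreg hhgt hprj D' htoF' hΘ hθ hrP hrPε hrP1⟩

end Summit.SmoothPoincare4.SmoothPoincare4.Cruxes.AgkCor6Sufficiency.LpBySphereSystemSurgery

end
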